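import Literature.Probability.LatticeModels.SixVertexGFFHeight
import Literature.Probability.LatticeModels.SixVertexTestPairingMoments
import Mathlib.MeasureTheory.Integral.Pi
import Mathlib.MeasureTheory.Integral.Prod
import Mathlib.MeasureTheory.Function.Floor

/-!
# Theorem 52: the moments of `⟨h^{(δ)}, ρ⟩` are integrals of the `k`-point functions
# (DKLM 2026, Part II §3)

H. Duminil-Copin, K. K. Kozlowski, P. Lammers, I. Manolescu, *Gaussian free field convergence of
the six-vertex model with `-1 ≤ Δ ≤ -1/2`*, arXiv:2603.06268 (2026) [DKLM2026SixVertexGFF]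
(`paper:arxiv-2603.06268`, chunk p0034):

> Fix `k ∈ ℤ_{≥1}`. […] In the discrete setting, Fubini's theorem can be applied to get
> `𝔼_{ℤ²}[⟨h^{(δ_n)}, φ⟩^k] = 𝔼[(∬ (h^{(δ_n)}(u') - h^{(δ_n)}(u)) dφ₊(u') dφ₋(u))^k]
>  = ∫ Φ_k^{(δ_n)}(u) dφ̃^k(u)` […] The integrand converges to `σ^k Ψ_k^GFF` […] it suffices to
> justify an application of the dominated convergence theorem […].

We formalize the Fubini step for the pairings `testPairing ω δ ρ = ∫ h^{(δ)}(ω, z) ρ(z) dz` of the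
statement file, using the base point `0` (where `h = 0` by the normalisation `heightAt ω 0 = 0`)
instead of the `φ₊/φ₋` splitting: for every probability measure `P` on configurations, every
continuous compactly supported `ρ`, every `δ` and `k`,

`𝔼_P[⟨h^{(δ)}, ρ⟩^k] = ∫_{ℂ^k} Φ_k^{(δ)}((0, z_i)_i) ∏ ρ(z_i) dz`

(`integral_testPairing_pow`; heights are bounded on bounded sets, `|h(f)| ≤ |f₁| + |f₂|`, so all
integrability is automatic). Consequently the pairings have all moments
(`integrable_testPairing_pow`) and Theorem 52's reduction to the moments
(`SixVertexTestPairingMoments.lean`) takes the form: convergence of these `k`-point integrals to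
the Gaussian moments gives the convergence in law of `⟨h^{(δ)}, ρ⟩`
(`tendsto_integral_testPairing_of_tendsto_kPoint_integrals`); and, as printed, the two-density
form for `ρ = ρ₁ − ρ₂` with `∫ρ₁ = ∫ρ₂ = 1` (the paper's `φ₊ − φ₋`, whose configurations
`u = (uᵢ, uᵢ')` are generic): `𝔼_P[⟨h^{(δ)}, ρ₁ − ρ₂⟩^k] = ∫ Φ_k^{(δ)}(u) ∏ ρ₂(uᵢ)ρ₁(uᵢ') du`
(`integral_testPairing_sub_pow`, `tendsto_integral_testPairing_sub_of_tendsto_kPoint_integrals`).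
-/

noncomputable section

open MeasureTheory ProbabilityTheory Filter Topology Function BoundedContinuousFunction

namespace Literature.Probability.LatticeModels.SixVertex

variable {P : Measure (Config (ℤ × ℤ))}

/-! ## 1. Joint measurability and the local bound of the scaled height function -/

/-- `(ω, z) ↦ h(ω, z)` is jointly measurable (piecewise constant in `z`). [folklore] -/
theorem measurable_heightPlane_uncurry : Measurable fun p : Config (ℤ × ℤ) × ℂ => heightPlane p.1 p.2 := by
  have h1 : Measurable fun q : Config (ℤ × ℤ) × (ℤ × ℤ) => heightAt q.1 q.2 :=
    measurable_from_prod_countable_left fun f => measurable_heightAt f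
  have h2 : Measurable fun p : Config (ℤ × ℤ) × ℂ => (p.1, (⌊p.2.re⌋, ⌊p.2.im⌋)) :=
    measurable_fst.prodMk
      ((Int.measurable_floor.comp (Complex.measurable_re.comp measurable_snd)).prodMk
        (Int.measurable_floor.comp (Complex.measurable_im.comp measurable_snd)))
  exact h1.comp h2

/-- `(ω, z) ↦ h^{(δ)}(ω, z)` (real-valued) is jointly measurable. [folklore] -/
theorem measurable_heightScaled_uncurry (δ : ℝ) :
    Measurable fun p : Config (ℤ × ℤ) × ℂ => (heightScaled p.1 δ p.2 : ℝ) := by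
  have h : Measurable fun p : Config (ℤ × ℤ) × ℂ => heightPlane p.1 (p.2 / δ) :=
    measurable_heightPlane_uncurry.comp (measurable_fst.prodMk (measurable_snd.div_const _))
  exact (measurable_of_countable (Int.cast : ℤ → ℝ)).comp h

/-- `|⌊x⌋| ≤ |x| + 1`. [folklore] -/
theorem abs_int_floor_le (x : ℝ) : |(⌊x⌋ : ℝ)| ≤ |x| + 1 := by
  have h1 := Int.floor_le x
  have h2 := Int.lt_floor_add_one x
  rw [abs_le]
  constructor <;> linarith [abs_le.1 (le_refl |x|), neg_abs_le x, le_abs_self x]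

/-- **Local bound** `|h^{(δ)}(ω, z)| ≤ 2|z|/|δ| + 2`. [folklore] -/
theorem abs_heightScaled_le (ω : Config (ℤ × ℤ)) (δ : ℝ) (z : ℂ) :
    |(heightScaled ω δ z : ℝ)| ≤ 2 * ‖z‖ / |δ| + 2 := by
  have h := abs_heightPlane_le ω (z / δ)
  have hre := abs_int_floor_le (z / δ).re
  have him := abs_int_floor_le (z / δ).im
  have h1 : |(z / δ).re| ≤ ‖z / (δ : ℂ)‖ := Complex.abs_re_le_norm _
  have h2 : |(z / δ).im| ≤ ‖z / (δ : ℂ)‖ := Complex.abs_im_le_norm _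
  have h3 : ‖z / (δ : ℂ)‖ = ‖z‖ / |δ| := by rw [norm_div, Complex.norm_real, Real.norm_eq_abs]
  unfold heightScaled
  calc |(heightPlane ω (z / δ) : ℝ)| ≤ |(⌊(z / δ).re⌋ : ℝ)| + |(⌊(z / δ).im⌋ : ℝ)| := h
    _ ≤ (‖z‖ / |δ| + 1) + (‖z‖ / |δ| + 1) := by rw [← h3]; linarith
    _ = 2 * ‖z‖ / |δ| + 2 := by ring

/-- The bound is uniform on the support of a compactly supported `ρ`: there is `B` with
`|h^{(δ)}(ω,z) ρ(z)| ≤ B |ρ(z)|` for all `ω, z`. [folklore] -/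
theorem exists_bound_heightScaled_mul {ρ : ℂ → ℝ} (hsupp : HasCompactSupport ρ) (δ : ℝ) :
    ∃ B : ℝ, 0 ≤ B ∧ ∀ (ω : Config (ℤ × ℤ)) (z : ℂ), |(heightScaled ω δ z : ℝ) * ρ z| ≤ B * |ρ z| := by
  obtain ⟨R, hR⟩ := hsupp.isCompact.isBounded.subset_closedBall 0
  refine ⟨2 * |R| / |δ| + 2, by positivity, fun ω z => ?_⟩
  by_cases hz : ρ z = 0
  · simp [hz]
  · have hzR : ‖z‖ ≤ |R| := by
      have : z ∈ Metric.closedBall (0 : ℂ) R := hR (subset_tsupport _ (Function.mem_support.2 hz))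
      rw [Metric.mem_closedBall, dist_zero_right] at this
      exact this.trans (le_abs_self R)
    rw [abs_mul]
    refine mul_le_mul_of_nonneg_right ((abs_heightScaled_le ω δ z).trans ?_) (abs_nonneg _)
    gcongr

/-! ## 2. Measurability and moments of the pairing -/

/-- `ω ↦ ⟨h^{(δ)}(ω), ρ⟩` is measurable. [folklore] -/
theorem measurable_testPairing {ρ : ℂ → ℝ} (hρ : Continuous ρ) (δ : ℝ) :
    Measurable fun ω : Config (ℤ × ℤ) => testPairing ω δ ρ := by
  have h : StronglyMeasurable fun p : Config (ℤ × ℤ) × ℂ => (heightScaled p.1 δ p.2 : ℝ) * ρ p.2 :=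
    ((measurable_heightScaled_uncurry δ).mul (hρ.measurable.comp measurable_snd)).stronglyMeasurable
  exact (h.integral_prod_right' (ν := volume)).measurable

/-- `|⟨h^{(δ)}(ω), ρ⟩| ≤ B ∫|ρ|` uniformly in `ω`. [folklore] -/
theorem abs_testPairing_le {ρ : ℂ → ℝ} (hρ : Continuous ρ) (hsupp : HasCompactSupport ρ) (δ : ℝ) :
    ∃ C : ℝ, ∀ ω : Config (ℤ × ℤ), |testPairing ω δ ρ| ≤ C := by
  obtain ⟨B, hB0, hB⟩ := exists_bound_heightScaled_mul hsupp δ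
  refine ⟨∫ z, B * |ρ z|, fun ω => ?_⟩
  rw [testPairing, ← Real.norm_eq_abs]
  refine norm_integral_le_of_norm_le ((hρ.integrable_of_hasCompactSupport hsupp).abs.const_mul B)
    (Eventually.of_forall fun z => ?_)
  rw [Real.norm_eq_abs]
  exact hB ω z

/-- **All moments of `⟨h^{(δ)}, ρ⟩` exist** under a probability measure. [folklore] -/
theorem integrable_testPairing_pow [IsProbabilityMeasure P] {ρ : ℂ → ℝ} (hρ : Continuous ρ) (hsupp : HasCompactSupport ρ)
    (δ : ℝ) (k : ℕ) : Integrable (fun ω => testPairing ω δ ρ ^ k) P := by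
  obtain ⟨C, hC⟩ := abs_testPairing_le hρ hsupp δ
  refine Integrable.of_bound ((measurable_testPairing hρ δ).pow_const k).aestronglyMeasurable (|C| ^ k)
    (Eventually.of_forall fun ω => ?_)
  rw [Real.norm_eq_abs, abs_pow]
  exact pow_le_pow_left₀ (abs_nonneg _) ((hC ω).trans (le_abs_self C)) k

/-! ## 3. The moment formula -/

/-- The Fubini integrand `(ω, z) ↦ ∏ᵢ h^{(δ)}(ω, zᵢ) ρ(zᵢ)` is integrable on `P ⊗ Leb^{⊗k}`.
[cite: DKLM2026SixVertexGFF, Part II §3, proof of Theorem 52] -/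
theorem integrable_prod_heightScaled_mul [IsProbabilityMeasure P] {ρ : ℂ → ℝ} (hρ : Continuous ρ)
    (hsupp : HasCompactSupport ρ) (δ : ℝ) (k : ℕ) :
    Integrable (fun p : Config (ℤ × ℤ) × (Fin k → ℂ) => ∏ i, ((heightScaled p.1 δ (p.2 i) : ℝ) * ρ (p.2 i)))
      (P.prod volume) := by
  obtain ⟨B, hB0, hB⟩ := exists_bound_heightScaled_mul hsupp δ
  have hmeas : Measurable fun p : Config (ℤ × ℤ) × (Fin k → ℂ) =>
      ∏ i, ((heightScaled p.1 δ (p.2 i) : ℝ) * ρ (p.2 i)) := by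
    refine Finset.measurable_prod _ fun i _ => ?_
    have hi : Measurable fun p : Config (ℤ × ℤ) × (Fin k → ℂ) => (p.1, p.2 i) :=
      measurable_fst.prodMk ((measurable_pi_apply i).comp measurable_snd)
    exact ((measurable_heightScaled_uncurry δ).comp hi).mul (hρ.measurable.comp ((measurable_pi_apply i).comp measurable_snd))
  have hρi : Integrable ρ volume := hρ.integrable_of_hasCompactSupport hsupp
  have hG : Integrable (fun p : Config (ℤ × ℤ) × (Fin k → ℂ) => (1 : ℝ) * ∏ i, (B * |ρ (p.2 i)|)) (P.prod volume) :=
    (integrable_const (1 : ℝ)).mul_prod (Integrable.fintype_prod (f := fun (_ : Fin k) (z : ℂ) => B * |ρ z|)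
      fun _ => hρi.abs.const_mul B)
  refine hG.mono' hmeas.aestronglyMeasurable (Eventually.of_forall fun p => ?_)
  rw [one_mul, Real.norm_eq_abs, Finset.abs_prod]
  exact Finset.prod_le_prod (fun i _ => abs_nonneg _) fun i _ => hB p.1 (p.2 i)

/-- `Φ_k^{(δ)}((0, zᵢ)ᵢ) = 𝔼_P[∏ᵢ h^{(δ)}(zᵢ)]` (the base point `0` has height `0`).
[cite: DKLM2026SixVertexGFF, Def. 2.4] -/
theorem kPointScaled_zero_base (P : Measure (Config (ℤ × ℤ))) (δ : ℝ) {k : ℕ} (z : Fin k → ℂ) :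
    kPointScaled P k δ (fun i => ((0 : ℂ), z i)) = ∫ ω, ∏ i, (heightScaled ω δ (z i) : ℝ) ∂P := by
  unfold kPointScaled kPoint heightScaled
  refine integral_congr_ae (Eventually.of_forall fun ω => ?_)
  simp [heightPlane]

/-- **The moment formula (Fubini step of Theorem 52).** For a probability measure `P` on
configurations, a continuous compactly supported density `ρ`, and all `δ`, `k`:
`𝔼_P[⟨h^{(δ)}, ρ⟩^k] = ∫_{ℂ^k} Φ_k^{(δ)}((0, zᵢ)ᵢ) ∏ᵢ ρ(zᵢ) dz`.
[cite: DKLM2026SixVertexGFF, Part II §3, proof of Theorem 52] -/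
theorem integral_testPairing_pow [IsProbabilityMeasure P] {ρ : ℂ → ℝ} (hρ : Continuous ρ) (hsupp : HasCompactSupport ρ)
    (δ : ℝ) (k : ℕ) :
    ∫ ω, testPairing ω δ ρ ^ k ∂P =
      ∫ z : Fin k → ℂ, kPointScaled P k δ (fun i => ((0 : ℂ), z i)) * ∏ i, ρ (z i) := by
  -- the power of the pairing is an integral over `ℂ^k`
  have h1 : ∀ ω : Config (ℤ × ℤ), testPairing ω δ ρ ^ k =
      ∫ z : Fin k → ℂ, ∏ i, ((heightScaled ω δ (z i) : ℝ) * ρ (z i)) := by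
    intro ω
    rw [integral_fintype_prod_volume_eq_pow (fun z : ℂ => (heightScaled ω δ z : ℝ) * ρ z), Fintype.card_fin]
    rfl
  simp_rw [h1]
  -- Fubini
  rw [integral_integral_swap (integrable_prod_heightScaled_mul hρ hsupp δ k)]
  refine integral_congr_ae (Eventually.of_forall fun z => ?_)
  simp only
  simp_rw [Finset.prod_mul_distrib]
  rw [integral_mul_const, kPointScaled_zero_base]

/-- **Theorem 52, convergence in law from the `k`-point integrals (DKLM Part II §3).** For a
probability measure `P`, a continuous compactly supported `ρ` and `v ≥ 0`: if for every `k` the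
integrals `∫ Φ_k^{(δ)}((0,zᵢ)ᵢ) ∏ ρ(zᵢ) dz` converge to the `k`-th moment of `𝒩(0, v)` as
`δ → 0⁺`, then `𝔼_P[g(⟨h^{(δ)}, ρ⟩)] → ∫ g d𝒩(0, v)` for every bounded continuous `g` (the mode-(2)
clause of Theorem 2.8 for `ρ`). [cite: DKLM2026SixVertexGFF, Part II §3, proof of Theorem 52] -/
theorem tendsto_integral_testPairing_of_tendsto_kPoint_integrals [IsProbabilityMeasure P] {ρ : ℂ → ℝ}
    (hρ : Continuous ρ) (hsupp : HasCompactSupport ρ) {v : NNReal}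
    (hmom : ∀ k : ℕ, Tendsto (fun δ => ∫ z : Fin k → ℂ, kPointScaled P k δ (fun i => ((0 : ℂ), z i)) * ∏ i, ρ (z i))
      (𝓝[>] (0 : ℝ)) (𝓝 (∫ x, x ^ k ∂gaussianReal 0 v)))
    (g : ℝ →ᵇ ℝ) :
    Tendsto (fun δ => ∫ ω, g (testPairing ω δ ρ) ∂P) (𝓝[>] (0 : ℝ)) (𝓝 (∫ x, g x ∂gaussianReal 0 v)) :=
  tendsto_integral_testPairing_of_tendsto_moments (fun δ => (measurable_testPairing hρ δ).aemeasurable)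
    (fun δ k => integrable_testPairing_pow hρ hsupp δ k)
    (fun k => by simpa only [integral_testPairing_pow hρ hsupp] using hmom k) g

/-! ## 4. The moment formula with two densities (the paper's `φ = φ₊ − φ₋`) -/

/-- `⟨h^{(δ)}, ρ₁ − ρ₂⟩ = ∬ (h^{(δ)}(u') − h^{(δ)}(u)) ρ₁(u') ρ₂(u) du du'` for densities with
`∫ρ₁ = ∫ρ₂ = 1`. [cite: DKLM2026SixVertexGFF, Part II §3, proof of Theorem 52] -/
theorem testPairing_sub_eq_integral_prod (ω : Config (ℤ × ℤ)) (δ : ℝ) {ρ₁ ρ₂ : ℂ → ℝ} (hρ₁ : Continuous ρ₁)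
    (hs₁ : HasCompactSupport ρ₁) (hρ₂ : Continuous ρ₂) (hs₂ : HasCompactSupport ρ₂) (h₁ : ∫ z, ρ₁ z = 1)
    (h₂ : ∫ z, ρ₂ z = 1) :
    testPairing ω δ (fun z => ρ₁ z - ρ₂ z) =
      ∫ p : ℂ × ℂ, ((heightScaled ω δ p.2 : ℝ) - heightScaled ω δ p.1) * (ρ₂ p.1 * ρ₁ p.2) := by
  obtain ⟨B₁, -, hB₁⟩ := exists_bound_heightScaled_mul hs₁ δ
  obtain ⟨B₂, -, hB₂⟩ := exists_bound_heightScaled_mul hs₂ δ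
  have hi₁ : Integrable ρ₁ volume := hρ₁.integrable_of_hasCompactSupport hs₁
  have hi₂ : Integrable ρ₂ volume := hρ₂.integrable_of_hasCompactSupport hs₂
  have hm : ∀ ρ : ℂ → ℝ, Continuous ρ → AEStronglyMeasurable (fun z => (heightScaled ω δ z : ℝ) * ρ z) volume :=
    fun ρ hρ => (((measurable_heightScaled_uncurry δ).comp (measurable_const.prodMk measurable_id)).mul
      hρ.measurable).aestronglyMeasurable
  have hI₁ : Integrable (fun z => (heightScaled ω δ z : ℝ) * ρ₁ z) volume :=
    (hi₁.abs.const_mul B₁).mono' (hm ρ₁ hρ₁) (Eventually.of_forall fun z => by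
      rw [Real.norm_eq_abs]; exact hB₁ ω z)
  have hI₂ : Integrable (fun z => (heightScaled ω δ z : ℝ) * ρ₂ z) volume :=
    (hi₂.abs.const_mul B₂).mono' (hm ρ₂ hρ₂) (Eventually.of_forall fun z => by
      rw [Real.norm_eq_abs]; exact hB₂ ω z)
  -- left-hand side
  have hL : testPairing ω δ (fun z => ρ₁ z - ρ₂ z) =
      (∫ z, (heightScaled ω δ z : ℝ) * ρ₁ z) - ∫ z, (heightScaled ω δ z : ℝ) * ρ₂ z := by
    rw [testPairing, ← integral_sub hI₁ hI₂]
    refine integral_congr_ae (Eventually.of_forall fun z => ?_)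
    simp only
    ring
  -- right-hand side: split the product integral
  have hR1 : Integrable (fun p : ℂ × ℂ => ρ₂ p.1 * ((heightScaled ω δ p.2 : ℝ) * ρ₁ p.2)) (volume.prod volume) :=
    hi₂.mul_prod hI₁
  have hR2 : Integrable (fun p : ℂ × ℂ => ((heightScaled ω δ p.1 : ℝ) * ρ₂ p.1) * ρ₁ p.2) (volume.prod volume) :=
    hI₂.mul_prod hi₁
  have hR : ∫ p : ℂ × ℂ, ((heightScaled ω δ p.2 : ℝ) - heightScaled ω δ p.1) * (ρ₂ p.1 * ρ₁ p.2) =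
      (∫ p : ℂ × ℂ, ρ₂ p.1 * ((heightScaled ω δ p.2 : ℝ) * ρ₁ p.2)) -
        ∫ p : ℂ × ℂ, ((heightScaled ω δ p.1 : ℝ) * ρ₂ p.1) * ρ₁ p.2 := by
    rw [Measure.volume_eq_prod, ← integral_sub hR1 hR2]
    refine integral_congr_ae (Eventually.of_forall fun p => ?_)
    simp only
    ring
  rw [hL, hR, Measure.volume_eq_prod, integral_prod_mul (fun x => ρ₂ x) (fun y => (heightScaled ω δ y : ℝ) * ρ₁ y),
    integral_prod_mul (fun x => (heightScaled ω δ x : ℝ) * ρ₂ x) (fun y => ρ₁ y), h₁, h₂]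
  ring

/-- The Fubini integrand `(ω, u) ↦ ∏ᵢ (h^{(δ)}(ω, uᵢ') − h^{(δ)}(ω, uᵢ)) ρ₂(uᵢ) ρ₁(uᵢ')` is
integrable on `P ⊗ Leb^{⊗k}`. [cite: DKLM2026SixVertexGFF, Part II §3, proof of Theorem 52] -/
theorem integrable_prod_heightScaled_sub_mul [IsProbabilityMeasure P] {ρ₁ ρ₂ : ℂ → ℝ} (hρ₁ : Continuous ρ₁)
    (hs₁ : HasCompactSupport ρ₁) (hρ₂ : Continuous ρ₂) (hs₂ : HasCompactSupport ρ₂) (δ : ℝ) (k : ℕ) :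
    Integrable (fun p : Config (ℤ × ℤ) × (Fin k → ℂ × ℂ) =>
      ∏ i, (((heightScaled p.1 δ (p.2 i).2 : ℝ) - heightScaled p.1 δ (p.2 i).1) * (ρ₂ (p.2 i).1 * ρ₁ (p.2 i).2)))
      (P.prod volume) := by
  obtain ⟨B₁, hB₁0, hB₁⟩ := exists_bound_heightScaled_mul hs₁ δ
  obtain ⟨B₂, hB₂0, hB₂⟩ := exists_bound_heightScaled_mul hs₂ δ
  have hi₁ : Integrable ρ₁ volume := hρ₁.integrable_of_hasCompactSupport hs₁
  have hi₂ : Integrable ρ₂ volume := hρ₂.integrable_of_hasCompactSupport hs₂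
  -- measurability
  have hmeas : Measurable fun p : Config (ℤ × ℤ) × (Fin k → ℂ × ℂ) =>
      ∏ i, (((heightScaled p.1 δ (p.2 i).2 : ℝ) - heightScaled p.1 δ (p.2 i).1) * (ρ₂ (p.2 i).1 * ρ₁ (p.2 i).2)) := by
    refine Finset.measurable_prod _ fun i _ => ?_
    have hi1 : Measurable fun p : Config (ℤ × ℤ) × (Fin k → ℂ × ℂ) => (p.2 i).1 :=
      measurable_fst.comp ((measurable_pi_apply i).comp measurable_snd)
    have hi2 : Measurable fun p : Config (ℤ × ℤ) × (Fin k → ℂ × ℂ) => (p.2 i).2 :=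
      measurable_snd.comp ((measurable_pi_apply i).comp measurable_snd)
    exact (((measurable_heightScaled_uncurry δ).comp (measurable_fst.prodMk hi2)).sub
      ((measurable_heightScaled_uncurry δ).comp (measurable_fst.prodMk hi1))).mul
      ((hρ₂.measurable.comp hi1).mul (hρ₁.measurable.comp hi2))
  -- the dominating function depends on `u` only
  have hpair : Integrable (fun q : ℂ × ℂ => (B₁ + B₂) * (|ρ₂ q.1| * |ρ₁ q.2|)) volume := by
    rw [Measure.volume_eq_prod]
    exact (hi₂.abs.mul_prod hi₁.abs).const_mul _
  have hG : Integrable (fun p : Config (ℤ × ℤ) × (Fin k → ℂ × ℂ) =>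
      (1 : ℝ) * ∏ i, ((B₁ + B₂) * (|ρ₂ (p.2 i).1| * |ρ₁ (p.2 i).2|))) (P.prod volume) :=
    (integrable_const (1 : ℝ)).mul_prod
      (Integrable.fintype_prod (f := fun (_ : Fin k) (q : ℂ × ℂ) => (B₁ + B₂) * (|ρ₂ q.1| * |ρ₁ q.2|)) fun _ => hpair)
  refine hG.mono' hmeas.aestronglyMeasurable (Eventually.of_forall fun p => ?_)
  rw [one_mul, Real.norm_eq_abs, Finset.abs_prod]
  refine Finset.prod_le_prod (fun i _ => abs_nonneg _) fun i _ => ?_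
  -- `|(h(u') - h(u)) ρ₂(u) ρ₁(u')| ≤ (B₁ + B₂) |ρ₂(u)| |ρ₁(u')|`
  have h1 := hB₁ p.1 (p.2 i).2
  have h2 := hB₂ p.1 (p.2 i).1
  rw [abs_mul] at h1 h2
  have e : ((heightScaled p.1 δ (p.2 i).2 : ℝ) - heightScaled p.1 δ (p.2 i).1) * (ρ₂ (p.2 i).1 * ρ₁ (p.2 i).2) =
      ((heightScaled p.1 δ (p.2 i).2 : ℝ) * ρ₁ (p.2 i).2) * ρ₂ (p.2 i).1 -
        ((heightScaled p.1 δ (p.2 i).1 : ℝ) * ρ₂ (p.2 i).1) * ρ₁ (p.2 i).2 := by ring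
  rw [e]
  calc |(heightScaled p.1 δ (p.2 i).2 : ℝ) * ρ₁ (p.2 i).2 * ρ₂ (p.2 i).1 -
        (heightScaled p.1 δ (p.2 i).1 : ℝ) * ρ₂ (p.2 i).1 * ρ₁ (p.2 i).2|
      ≤ |(heightScaled p.1 δ (p.2 i).2 : ℝ) * ρ₁ (p.2 i).2 * ρ₂ (p.2 i).1| +
        |(heightScaled p.1 δ (p.2 i).1 : ℝ) * ρ₂ (p.2 i).1 * ρ₁ (p.2 i).2| := abs_sub _ _
    _ = |(heightScaled p.1 δ (p.2 i).2 : ℝ)| * |ρ₁ (p.2 i).2| * |ρ₂ (p.2 i).1| +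
        |(heightScaled p.1 δ (p.2 i).1 : ℝ)| * |ρ₂ (p.2 i).1| * |ρ₁ (p.2 i).2| := by
        simp only [abs_mul]
    _ ≤ B₁ * |ρ₁ (p.2 i).2| * |ρ₂ (p.2 i).1| + B₂ * |ρ₂ (p.2 i).1| * |ρ₁ (p.2 i).2| := by
        gcongr
    _ = (B₁ + B₂) * (|ρ₂ (p.2 i).1| * |ρ₁ (p.2 i).2|) := by ring

/-- **The moment formula with two densities (Fubini step of Theorem 52, as printed).** For a
probability measure `P`, continuous compactly supported densities `ρ₁, ρ₂` with `∫ρ₁ = ∫ρ₂ = 1`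
(the paper's `φ₊, φ₋`), and all `δ`, `k`:
`𝔼_P[⟨h^{(δ)}, ρ₁ − ρ₂⟩^k] = ∫_{(ℂ×ℂ)^k} Φ_k^{(δ)}(u) ∏ᵢ ρ₂(uᵢ) ρ₁(uᵢ') du`, where
`Φ_k^{(δ)}(u) = kPointScaled P k δ u = 𝔼_P[∏ᵢ (h^{(δ)}(uᵢ') − h^{(δ)}(uᵢ))]`.
[cite: DKLM2026SixVertexGFF, Part II §3, proof of Theorem 52] -/
theorem integral_testPairing_sub_pow [IsProbabilityMeasure P] {ρ₁ ρ₂ : ℂ → ℝ} (hρ₁ : Continuous ρ₁)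
    (hs₁ : HasCompactSupport ρ₁) (hρ₂ : Continuous ρ₂) (hs₂ : HasCompactSupport ρ₂) (h₁ : ∫ z, ρ₁ z = 1)
    (h₂ : ∫ z, ρ₂ z = 1) (δ : ℝ) (k : ℕ) :
    ∫ ω, testPairing ω δ (fun z => ρ₁ z - ρ₂ z) ^ k ∂P =
      ∫ u : Fin k → ℂ × ℂ, kPointScaled P k δ u * ∏ i, (ρ₂ (u i).1 * ρ₁ (u i).2) := by
  have h1 : ∀ ω : Config (ℤ × ℤ), testPairing ω δ (fun z => ρ₁ z - ρ₂ z) ^ k =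
      ∫ u : Fin k → ℂ × ℂ, ∏ i, (((heightScaled ω δ (u i).2 : ℝ) - heightScaled ω δ (u i).1) *
        (ρ₂ (u i).1 * ρ₁ (u i).2)) := by
    intro ω
    rw [testPairing_sub_eq_integral_prod ω δ hρ₁ hs₁ hρ₂ hs₂ h₁ h₂,
      integral_fintype_prod_volume_eq_pow
        (fun p : ℂ × ℂ => ((heightScaled ω δ p.2 : ℝ) - heightScaled ω δ p.1) * (ρ₂ p.1 * ρ₁ p.2)),
      Fintype.card_fin]
  simp_rw [h1]
  rw [integral_integral_swap (integrable_prod_heightScaled_sub_mul hρ₁ hs₁ hρ₂ hs₂ δ k)]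
  refine integral_congr_ae (Eventually.of_forall fun u => ?_)
  simp only
  simp_rw [Finset.prod_mul_distrib]
  rw [integral_mul_const]
  congr 1

/-- **Theorem 52, convergence in law from the `k`-point integrals, two-density form (DKLM Part II
§3).** With `ρ₁, ρ₂` as above and `v ≥ 0`: if `∫ Φ_k^{(δ)}(u) ∏ ρ₂(uᵢ)ρ₁(uᵢ') du` converges to the
`k`-th moment of `𝒩(0, v)` as `δ → 0⁺` for every `k`, then `⟨h^{(δ)}, ρ₁ − ρ₂⟩ → 𝒩(0, v)` in law
(tested against bounded continuous functions). [cite: DKLM2026SixVertexGFF, Part II §3, proof of Theorem 52] -/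
theorem tendsto_integral_testPairing_sub_of_tendsto_kPoint_integrals [IsProbabilityMeasure P] {ρ₁ ρ₂ : ℂ → ℝ}
    (hρ₁ : Continuous ρ₁) (hs₁ : HasCompactSupport ρ₁) (hρ₂ : Continuous ρ₂) (hs₂ : HasCompactSupport ρ₂)
    (h₁ : ∫ z, ρ₁ z = 1) (h₂ : ∫ z, ρ₂ z = 1) {v : NNReal}
    (hmom : ∀ k : ℕ, Tendsto (fun δ => ∫ u : Fin k → ℂ × ℂ, kPointScaled P k δ u * ∏ i, (ρ₂ (u i).1 * ρ₁ (u i).2))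
      (𝓝[>] (0 : ℝ)) (𝓝 (∫ x, x ^ k ∂gaussianReal 0 v)))
    (g : ℝ →ᵇ ℝ) :
    Tendsto (fun δ => ∫ ω, g (testPairing ω δ (fun z => ρ₁ z - ρ₂ z)) ∂P) (𝓝[>] (0 : ℝ))
      (𝓝 (∫ x, g x ∂gaussianReal 0 v)) :=
  have hρ : Continuous fun z => ρ₁ z - ρ₂ z := hρ₁.sub hρ₂
  have hs : HasCompactSupport fun z => ρ₁ z - ρ₂ z := hs₁.sub hs₂
  tendsto_integral_testPairing_of_tendsto_moments (fun δ => (measurable_testPairing hρ δ).aemeasurable)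
    (fun δ k => integrable_testPairing_pow hρ hs δ k)
    (fun k => by simpa only [integral_testPairing_sub_pow hρ₁ hs₁ hρ₂ hs₂ h₁ h₂] using hmom k) g

end Literature.Probability.LatticeModels.SixVertex

end
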